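import Literature.AnabelianGeometry.EtaleTheta.SettingModelSlice2Axis
import HarnessLib

/-!
# (L3′) slice 2, file 6/13 — (W) the wreath quotient `F̂₂ → (ℤ/N)^{ℤ/4} ⋊ ℤ/4` and the `b`-content of `(a b^k)^δ a^{-δ}`

Part of the (L3′) slice-2 chain (abc-iut-L6-t19; FILING SHAPE derived from scratch v5 `Slice2TheoremR2ScratchV5.lean`
551b982286441a66 by the edits E1–E4/D1–D3/H1–H2 of FILING-PLAN-SLICE2.md 9643c7e42a42ad24 and the OPTION-L re-cut of §F v1.19gz (W):
one definitions file + twelve theorem files).  Classical profinite group theory about OUR semi-synthetic `F₂hatT`; the objects and laws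
are those of the one-sentence residual of record (cf. [EtTh] §1, §2 for the role they play there — nothing of [EtTh]/[IUTchII]/[IUTchIII]
in print is asserted; no side on [IUTchIII] Cor. 3.12; MORATORIUM (E): no application to `hext_at_iff_exists_f2hatAut_of_eq`).
-/

noncomputable section

open scoped Pointwise

namespace Literature.AnabelianGeometry.EtaleTheta.SettingModel.Slice2

open Literature.AnabelianGeometry.EtaleTheta.SettingModel
open Literature.AnabelianGeometry.EtaleTheta (ZHatLevel.level ZHatLevel.levelChar)
open Literature.AnabelianGeometry.SemiGraphs (GQp)
open Literature.AnabelianGeometry.AbsoluteAnabelian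
open Literature.AnabelianGeometry.AbsoluteAnabelian.AbsTopII
open _root_.Topology

/-! ## §10 (W) THE WREATH QUOTIENT `F̂₂ → (ℤ/N)^{ℤ/4} ⋊ ℤ/4` and the `b`-content of `(a b^k)^δ a^{-δ}`

Target: if `(a b^{k₀})^δ a^{-δ} ∈ B · β_δ^Ẑ` (`k₀ > 0` an integer) then `δ ∈ {0, 1, −1} ⊂ Ẑ`.
The finite quotient `a ↦ shift`, `b ↦ δ_0` records, for elements of degree `≡ 0 (mod 4)`, the `b`-content at
each residue class mod `4` (PL3-DESK (N2) / PL3-R2 S0 «b-CONTENT», here at the fixed level `n = 4`). -/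

section Wreath

open SemidirectProduct

variable (N : ℕ+)

/-- `δ_c^v · δ_c^{v'} = δ_c^{v+v'}`. [cite: MochizukiEtTh2009, §1 p.12] -/
theorem wDelta_mul (c : ZMod 4) (v v' : ZMod N) : wDelta N c v * wDelta N c v' = wDelta N c (v + v') := by
  funext z; simp only [Pi.mul_apply, wDelta_apply]; split_ifs <;> simp [ofAdd_add]

/-- `(δ_c^v)^k = δ_c^{k v}`. [cite: MochizukiEtTh2009, §1 p.12] -/
theorem wDelta_pow (c : ZMod 4) (v : ZMod N) (k : ℕ) : wDelta N c v ^ k = wDelta N c (k * v) := by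
  induction k with
  | zero => funext z; simp
  | succ k ih => rw [pow_succ, ih, wDelta_mul]; congr 1; push_cast; ring

/-- [cite: MochizukiEtTh2009, §1 p.12] -/
theorem omegaW_of_zero : omegaW N (FreeGroup.of 0) = inr (Multiplicative.ofAdd 1) := by
  simp [omegaW]

/-- [cite: MochizukiEtTh2009, §1 p.12] -/
theorem omegaW_of_one : omegaW N (FreeGroup.of 1) = inl (wDelta N 0 1) := by
  simp [omegaW]

/-- **`ω̂(x^δ) = ω̂(x)^D`** where `D` is the representative of `δ` modulo any multiple `E` of `|W_N|`
(`δ = z^E · η(D)`; `w^{|W|} = 1`). [cite: MochizukiEtTh2009, §1 p.12] -/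
theorem omegaHat_powHat (x : F₂hatT) (δ : ZH) (E : ℕ+) (hE : Nat.card (WG N) ∣ (E : ℕ)) :
    omegaHat N (powHat x δ) = omegaHat N x ^ (Multiplicative.toAdd (ZHatLevel.level E δ)).val := by
  haveI : Finite (WG N) := finite_WG N
  haveI : NeZero (E : ℕ) := ⟨E.ne_zero⟩
  set D : ℕ := (Multiplicative.toAdd (ZHatLevel.level E δ)).val with hD
  have hk : ZHatLevel.level E δ = ZHatLevel.level E (ZHatLevel.eta (D : ℤ)) := by
    rw [ZHatLevel.level_eta, Int.cast_natCast, hD, ZMod.natCast_zmod_val, ofAdd_toAdd]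
  have h1 : ZHatLevel.level E (δ * (ZHatLevel.eta (D : ℤ))⁻¹) = 1 := by
    rw [map_mul, map_inv, hk, mul_inv_cancel]
  obtain ⟨z, hz⟩ := (ZHatLevel.level_eq_one_iff_exists_pow E _).mp h1
  have hδ : δ = z ^ (E : ℕ) * ZHatLevel.eta (D : ℤ) := by rw [hz, inv_mul_cancel_right]
  have hpow : powHat x (ZHatLevel.eta (D : ℤ)) = x ^ D := by
    change powHat x (iotaZ (Multiplicative.ofAdd (D : ℤ))) = _
    rw [powHat_iotaZ, toAdd_ofAdd, zpow_natCast]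
  obtain ⟨c, hc⟩ := hE
  rw [hδ, map_mul, map_pow, hpow, map_mul, map_pow, map_pow, hc, pow_mul, pow_card_eq_one', one_pow, one_mul]

/-- `ω̂(a^δ) = (0, D)`. [cite: MochizukiEtTh2009, §1 p.12] -/
theorem omegaHat_aPow (δ : ZH) (E : ℕ+) (hE : Nat.card (WG N) ∣ (E : ℕ)) :
    omegaHat N (aPow δ) = inr (Multiplicative.ofAdd ((Multiplicative.toAdd (ZHatLevel.level E δ)).val : ZMod 4)) := by
  rw [aPow, omegaHat_powHat N _ _ E hE, omegaHat_eta, omegaW_of_zero, ← map_pow, ← ofAdd_nsmul, nsmul_one]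

/-- `ω̂(b^w) = (δ_0^{c}, 0)` for some `c`. [cite: MochizukiEtTh2009, §1 p.12] -/
theorem omegaHat_bPow (w : ZH) : ∃ c : ZMod N, omegaHat N (bPow w) = inl (wDelta N 0 c) := by
  haveI : Finite (WG N) := finite_WG N
  obtain ⟨E, hE⟩ : ∃ E : ℕ+, Nat.card (WG N) ∣ (E : ℕ) := ⟨⟨Nat.card (WG N), Nat.card_pos⟩, dvd_rfl⟩
  refine ⟨((Multiplicative.toAdd (ZHatLevel.level E w)).val : ZMod N), ?_⟩
  rw [bPow_eq_powHat, omegaHat_powHat N _ _ E hE, omegaHat_eta, omegaW_of_one, ← map_pow, wDelta_pow, mul_one]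

/-- Conjugating a base element supported at `0` by `(0, c)` moves its support to `c`. [cite: MochizukiEtTh2009, §1 p.12] -/
theorem inr_mul_inl_wDelta_mul_inr_inv (c : ZMod 4) (v : ZMod N) :
    (inr (Multiplicative.ofAdd c) * inl (wDelta N 0 v) * (inr (Multiplicative.ofAdd c))⁻¹ : WG N) =
      inl (wDelta N c v) := by
  rw [← map_inv, ← inl_aut]
  congr 1
  funext z
  simp only [wShift_apply, toAdd_ofAdd, wDelta_apply, sub_eq_zero]

/-- `ω̂(β_δ^w) = (δ_{D̄}^c, 0)` for some `c`, `D̄ = δ mod 4`. [cite: MochizukiEtTh2009, §1 p.12] -/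
theorem omegaHat_betaPow (δ w : ZH) (E : ℕ+) (hE : Nat.card (WG N) ∣ (E : ℕ)) :
    ∃ c : ZMod N, omegaHat N (betaPow δ w) =
      inl (wDelta N (((Multiplicative.toAdd (ZHatLevel.level E δ)).val : ℕ) : ZMod 4) c) := by
  obtain ⟨c, hc⟩ := omegaHat_bPow N w
  refine ⟨c, ?_⟩
  rw [betaPow, map_mul, map_mul, map_inv, omegaHat_aPow N δ E hE, hc, inr_mul_inl_wDelta_mul_inr_inv]

/-! ### The `b`-content of `(a b^{k₀})^D` at the residues mod `4` -/

/-- [cite: MochizukiEtTh2009, §1 p.12] -/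
@[simp] theorem cnt4_zero (z : ZMod 4) : cnt4 0 z = 0 := rfl

/-- [cite: MochizukiEtTh2009, §1 p.12] -/
theorem cnt4_succ (D : ℕ) (z : ZMod 4) : cnt4 (D + 1) z = cnt4 D z + if ((D + 1 : ℕ) : ZMod 4) = z then 1 else 0 := rfl

/-- Four consecutive letters hit every residue exactly once. [cite: MochizukiEtTh2009, §1 p.12] -/
theorem cnt4_add_four (D : ℕ) (z : ZMod 4) : cnt4 (D + 4) z = cnt4 D z + 1 := by
  have key : ∀ d z : ZMod 4, ((if d + 1 = z then 1 else 0) + (if d + 2 = z then 1 else 0) +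
      (if d + 3 = z then 1 else 0) + (if d + 4 = z then 1 else 0) : ℕ) = 1 := by decide
  rw [show D + 4 = D + 1 + 1 + 1 + 1 from rfl, cnt4_succ, cnt4_succ, cnt4_succ, cnt4_succ]
  have h := key (D : ZMod 4) z
  push_cast at h ⊢
  simp only [add_assoc] at h ⊢
  norm_num at h ⊢
  omega

/-- `cnt4 (4Q + y) z = Q + cnt4 y z`. [cite: MochizukiEtTh2009, §1 p.12] -/
theorem cnt4_four_mul_add (Q y : ℕ) (z : ZMod 4) : cnt4 (4 * Q + y) z = Q + cnt4 y z := by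
  induction Q with
  | zero => simp
  | succ Q ih => rw [show 4 * (Q + 1) + y = 4 * Q + y + 4 by ring, cnt4_add_four, ih]; ring

/-- The shift moves `δ_0` to `δ_c`. [cite: MochizukiEtTh2009, §1 p.12] -/
theorem wShift_wDelta_zero (c : Multiplicative (ZMod 4)) (v : ZMod N) :
    wShift N c (wDelta N 0 v) = wDelta N (Multiplicative.toAdd c) v := by
  funext z; simp only [wShift_apply, wDelta_apply, sub_eq_zero]

/-- `ω(a b^{k₀}) = ⟨δ_1^{k₀}, 1⟩`. [cite: MochizukiEtTh2009, §1 p.12] -/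
theorem omegaW_gen (k₀ : ℕ) :
    omegaW N (FreeGroup.of 0 * FreeGroup.of 1 ^ k₀) = ⟨wDelta N 1 (k₀ : ZMod N), Multiplicative.ofAdd 1⟩ := by
  rw [map_mul, map_pow, omegaW_of_zero, omegaW_of_one, ← map_pow, wDelta_pow, mul_one]
  refine SemidirectProduct.ext ?_ ?_
  · simp only [mul_left, left_inr, right_inr, left_inl, one_mul, wShift_wDelta_zero, toAdd_ofAdd]
  · simp

/-- **`ω((a b^{k₀})^D) = ⟨z ↦ k₀·cnt4 D z, D⟩`**: the `b`-content of `(a b^{k₀})^D` at residue `z` is `k₀` times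
the number of `j ∈ [1, D]` with `j ≡ z (mod 4)`. [cite: MochizukiEtTh2009, §1 p.12] -/
theorem omegaW_gen_pow (k₀ D : ℕ) :
    omegaW N ((FreeGroup.of 0 * FreeGroup.of 1 ^ k₀) ^ D) =
      ⟨fun z => Multiplicative.ofAdd (((k₀ * cnt4 D z : ℕ) : ZMod N)), Multiplicative.ofAdd (D : ZMod 4)⟩ := by
  induction D with
  | zero =>
    rw [pow_zero, map_one]
    refine SemidirectProduct.ext ?_ ?_
    · funext z; simp
    · simp
  | succ D ih =>
    rw [pow_succ, map_mul, ih, omegaW_gen]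
    refine SemidirectProduct.ext ?_ ?_
    · funext z
      simp only [mul_left, Pi.mul_apply, wShift_apply, toAdd_ofAdd, wDelta_apply, cnt4_succ, Nat.cast_add,
        Nat.cast_one]
      by_cases hz : z - (D : ZMod 4) = 1
      · have hz' : ((D : ZMod 4) + 1) = z := by rw [← hz]; ring
        rw [if_pos hz, if_pos hz']
        rw [← ofAdd_add]; congr 1; push_cast; ring
      · have hz' : ¬ ((D : ZMod 4) + 1) = z := fun h => hz (by rw [← h]; ring)
        rw [if_neg hz, if_neg hz', mul_one, add_zero]
    · simp only [mul_right, Nat.cast_add, Nat.cast_one, ofAdd_add]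

/-- **`ω̂((a b^{k₀})^δ a^{-δ}) = inl (z ↦ k₀·cnt4 D z)`**, `D` the representative of `δ` modulo a multiple `E` of
`|W_N|`. [cite: MochizukiEtTh2009, §1 p.12] -/
theorem omegaHat_cElt (k₀ : ℕ) (δ : ZH) (E : ℕ+) (hE : Nat.card (WG N) ∣ (E : ℕ)) :
    omegaHat N (powHat (ea * bPow (ZHatLevel.eta (k₀ : ℤ))) δ * (aPow δ)⁻¹) =
      inl (fun z => Multiplicative.ofAdd
        (((k₀ * cnt4 (Multiplicative.toAdd (ZHatLevel.level E δ)).val z : ℕ) : ZMod N))) := by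
  have hg : ea * bPow (ZHatLevel.eta (k₀ : ℤ)) = eta (FreeGroup.of 0 * FreeGroup.of 1 ^ k₀) := by
    rw [bPow_eta, map_mul, map_pow, zpow_natCast]
  rw [map_mul, map_inv, omegaHat_powHat N _ _ E hE, omegaHat_aPow N δ E hE, hg, omegaHat_eta, ← map_pow,
    omegaW_gen_pow]
  refine SemidirectProduct.ext ?_ ?_
  · simp
  · simp

/-- Casting levels down a divisibility. [cite: RibesZalesskii2010, Thm 2.7.1] -/
theorem cast_level_of_dvd {n L : ℕ+} (h : (n : ℕ) ∣ L) (x : ZH) :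
    ZMod.castHom h (ZMod n) (Multiplicative.toAdd (ZHatLevel.level L x)) = Multiplicative.toAdd (ZHatLevel.level n x) := by
  obtain ⟨c, rfl⟩ : ∃ c : ℕ+, L = n * c := PNat.dvd_iff.2 h
  exact ZHatLevel.cast_level_mul n c x

/-! ### The level-`4M` conclusion, and the final step `δ ∈ {0, ±1}` -/

/-- Small table: `cnt4 y z` for `y ≤ 3`. [cite: MochizukiEtTh2009, §1 p.12] -/
theorem cnt4_table :
    cnt4 0 1 = 0 ∧ cnt4 1 2 = 0 ∧ cnt4 2 1 = 1 ∧ cnt4 2 3 = 0 ∧ cnt4 3 1 = 1 := by decide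

/-- **(W) at level `4M`**: if `(a b^{k₀})^δ a^{-δ} = b^v β_δ^{v'}` with `k₀ > 0`, then `δ ≡ 0, 1` or `−1 (mod 4M)`
for every `M ≥ 2`.  (Content at residues `z ∉ {0, δ̄}` vanishes mod `k₀M`, i.e. `M ∣ cnt4 D z`; with
`D = 4Q + y` the four cases `y = 0,1,2,3` give `Q ≡ 0`, `Q ≡ 0`, contradiction, `Q ≡ −1`.)
[cite: MochizukiEtTh2009, §1 p.12] -/
theorem level_mem_of_cElt_eq {k₀ : ℕ} (hk : 0 < k₀) (M : ℕ+) (hM : 2 ≤ (M : ℕ)) {δ v v' : ZH}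
    (h : powHat (ea * bPow (ZHatLevel.eta (k₀ : ℤ))) δ * (aPow δ)⁻¹ = bPow v * betaPow δ v') :
    Multiplicative.toAdd (ZHatLevel.level (4 * M) δ) = 0 ∨ Multiplicative.toAdd (ZHatLevel.level (4 * M) δ) = 1 ∨
      Multiplicative.toAdd (ZHatLevel.level (4 * M) δ) = -1 := by
  -- the wreath quotient with base modulus `N := k₀ M`
  let N : ℕ+ := ⟨k₀ * M, Nat.mul_pos hk M.pos⟩
  haveI : Finite (WG N) := finite_WG N
  let C : ℕ+ := ⟨Nat.card (WG N), Nat.card_pos⟩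
  let E : ℕ+ := (4 * M) * C
  have hE : Nat.card (WG N) ∣ (E : ℕ) := ⟨4 * M, by simp [E, C, mul_comm]⟩
  set D := (Multiplicative.toAdd (ZHatLevel.level E δ)).val with hD
  -- apply `ω̂`
  have hL := omegaHat_cElt N k₀ δ E hE
  obtain ⟨c, hc⟩ := omegaHat_bPow N v
  obtain ⟨c', hc'⟩ := omegaHat_betaPow N δ v' E hE
  rw [h, map_mul, hc, hc', ← map_mul, inl_inj, ← hD] at hL
  -- read off residues
  have hres : ∀ z : ZMod 4, z ≠ 0 → z ≠ (D : ZMod 4) → (M : ℕ) ∣ cnt4 D z := by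
    intro z hz0 hzD
    have := congrFun hL z
    simp only [Pi.mul_apply, wDelta_apply, if_neg hz0, if_neg hzD, mul_one] at this
    -- `ofAdd (k₀ cnt) = 1` in `ZMod (k₀ M)`
    have h0 : (((k₀ * cnt4 D z : ℕ) : ZMod N)) = 0 := by
      have := congrArg Multiplicative.toAdd this
      rwa [toAdd_one, toAdd_ofAdd, eq_comm] at this
    rw [ZMod.natCast_eq_zero_iff] at h0
    change k₀ * (M : ℕ) ∣ k₀ * cnt4 D z at h0
    exact (Nat.mul_dvd_mul_iff_left hk).mp h0
  -- `D = 4Q + y`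
  obtain ⟨Q, y, hy, hDQ⟩ : ∃ Q y : ℕ, y < 4 ∧ D = 4 * Q + y := ⟨D / 4, D % 4, Nat.mod_lt _ (by norm_num),
    (Nat.div_add_mod D 4).symm⟩
  have hDmod : (D : ZMod 4) = (y : ZMod 4) := by
    rw [hDQ]; push_cast; rw [show (4 : ZMod 4) = 0 from rfl]; ring
  obtain ⟨t0, t1, t2, t3, t4⟩ := cnt4_table
  -- the level-`4M` residue of `δ` is `D mod 4M`
  have hlev : Multiplicative.toAdd (ZHatLevel.level (4 * M) δ) = (D : ZMod ((4 * M : ℕ+) : ℕ)) := by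
    have hc := cast_level_of_dvd (n := 4 * M) (L := E) (PNat.dvd_iff.1 (dvd_mul_right (4 * M) C)) δ
    rw [← hc]
    haveI : NeZero ((E : ℕ+) : ℕ) := ⟨E.ne_zero⟩
    rw [← ZMod.natCast_zmod_val (Multiplicative.toAdd (ZHatLevel.level E δ)), map_natCast, hD]
  have hcoe : ((4 * M : ℕ+) : ℕ) = 4 * (M : ℕ) := by simp
  rw [hlev, hDQ]
  have hM1 : ¬ ((M : ℕ) ∣ 1) := fun h1 => by have := Nat.le_of_dvd Nat.one_pos h1; omega
  have hzero : ∀ q : ℕ, ((4 * ((M : ℕ) * q) : ℕ) : ZMod ((4 * M : ℕ+) : ℕ)) = 0 := fun q => by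
    rw [ZMod.natCast_eq_zero_iff, hcoe]; exact ⟨q, by ring⟩
  interval_cases y
  · -- y = 0 : residue 1 gives `M ∣ Q`
    left
    have h1 := hres 1 (by decide) (by rw [hDmod]; decide)
    rw [hDQ, cnt4_four_mul_add, t0, add_zero] at h1
    obtain ⟨q, hq⟩ := h1
    rw [add_zero, hq]
    exact hzero q
  · -- y = 1 : residue 2 gives `M ∣ Q`
    right; left
    have h1 := hres 2 (by decide) (by rw [hDmod]; decide)
    rw [hDQ, cnt4_four_mul_add, t1, add_zero] at h1
    obtain ⟨q, hq⟩ := h1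
    rw [Nat.cast_add, hq, hzero q, zero_add, Nat.cast_one]
  · -- y = 2 : residues 1 and 3 give `M ∣ Q + 1` and `M ∣ Q`: contradiction
    exfalso
    have h1 := hres 1 (by decide) (by rw [hDmod]; decide)
    have h3 := hres 3 (by decide) (by rw [hDmod]; decide)
    rw [hDQ, cnt4_four_mul_add, t2] at h1
    rw [hDQ, cnt4_four_mul_add, t3, add_zero] at h3
    exact hM1 ((Nat.dvd_add_right h3).mp h1)
  · -- y = 3 : residue 1 gives `M ∣ Q + 1`
    right; right
    have h1 := hres 1 (by decide) (by rw [hDmod]; decide)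
    rw [hDQ, cnt4_four_mul_add, t4] at h1
    obtain ⟨q, hq⟩ := h1
    have hQ : 4 * Q + 3 + 1 = 4 * ((M : ℕ) * q) := by omega
    have h0 : ((4 * Q + 3 : ℕ) : ZMod ((4 * M : ℕ+) : ℕ)) + 1 = 0 := by
      rw [← Nat.cast_add_one, hQ]; exact hzero q
    exact eq_neg_of_add_eq_zero_left h0

/-- Casting `{0, 1, −1}` down a divisibility. [cite: RibesZalesskii2010, Thm 2.7.1] -/
theorem level_trichotomy_of_mul (n m : ℕ+) (δ : ZH)
    (h : Multiplicative.toAdd (ZHatLevel.level (n * m) δ) = 0 ∨ Multiplicative.toAdd (ZHatLevel.level (n * m) δ) = 1 ∨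
      Multiplicative.toAdd (ZHatLevel.level (n * m) δ) = -1) :
    Multiplicative.toAdd (ZHatLevel.level n δ) = 0 ∨ Multiplicative.toAdd (ZHatLevel.level n δ) = 1 ∨
      Multiplicative.toAdd (ZHatLevel.level n δ) = -1 := by
  rw [← cast_level_of_dvd (n := n) (L := n * m) (PNat.dvd_iff.1 (dvd_mul_right n m)) δ]
  rcases h with h | h | h <;> rw [h]
  · left; exact map_zero _
  · right; left; exact map_one _
  · right; right; rw [map_neg, map_one]

/-- **(W) THE WREATH LEMMA**: if `(a b^{k₀})^δ a^{-δ} ∈ B · β_δ^Ẑ` with `k₀ > 0`, then `δ ∈ {0, 1, −1}` in `Ẑ`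
(multiplicative spelling: `δ = 1 ∨ δ = η 1 ∨ δ = η(−1)`). [cite: MochizukiEtTh2009, §1 p.12] -/
theorem eq_of_cElt_eq {k₀ : ℕ} (hk : 0 < k₀) {δ v v' : ZH}
    (h : powHat (ea * bPow (ZHatLevel.eta (k₀ : ℤ))) δ * (aPow δ)⁻¹ = bPow v * betaPow δ v') :
    δ = 1 ∨ δ = ZHatLevel.eta 1 ∨ δ = ZHatLevel.eta (-1) := by
  -- every level is `0, 1` or `−1`
  have hall : ∀ L : ℕ+, Multiplicative.toAdd (ZHatLevel.level L δ) = 0 ∨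
      Multiplicative.toAdd (ZHatLevel.level L δ) = 1 ∨ Multiplicative.toAdd (ZHatLevel.level L δ) = -1 := by
    intro L
    have h4 := level_mem_of_cElt_eq hk (L * 2)
      (by rw [PNat.mul_coe, show ((2 : ℕ+) : ℕ) = 2 from rfl]; have := L.pos; omega) h
    rw [show (4 : ℕ+) * (L * 2) = L * (4 * 2) by ring] at h4
    exact level_trichotomy_of_mul L (4 * 2) δ h4
  -- the 3-adic digit decides: compare the levels `3L`, `3`, `L`
  have d10 : ((1 : ZMod ((3 : ℕ+) : ℕ))) ≠ 0 := by decide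
  have d20 : ((-1 : ZMod ((3 : ℕ+) : ℕ))) ≠ 0 := by decide
  have d21 : ((-1 : ZMod ((3 : ℕ+) : ℕ))) ≠ 1 := by decide
  rcases hall 3 with h3 | h3 | h3
  · left
    refine ZHatLevel.ext_of_level fun L => ?_
    have c3 := cast_level_of_dvd (n := 3) (L := 3 * L) (PNat.dvd_iff.1 (dvd_mul_right 3 L)) δ
    have cL := cast_level_of_dvd (n := L) (L := 3 * L) (PNat.dvd_iff.1 (dvd_mul_left L 3)) δ
    rw [map_one]
    apply Multiplicative.toAdd.injective
    rw [toAdd_one, ← cL]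
    rcases hall (3 * L) with e | e | e
    · rw [e, map_zero]
    · rw [e, map_one] at c3; rw [h3] at c3; exact absurd c3 d10
    · rw [e, map_neg, map_one] at c3; rw [h3] at c3; exact absurd c3 d20
  · right; left
    refine ZHatLevel.ext_of_level fun L => ?_
    have c3 := cast_level_of_dvd (n := 3) (L := 3 * L) (PNat.dvd_iff.1 (dvd_mul_right 3 L)) δ
    have cL := cast_level_of_dvd (n := L) (L := 3 * L) (PNat.dvd_iff.1 (dvd_mul_left L 3)) δ
    rw [ZHatLevel.level_eta, Int.cast_one]
    apply Multiplicative.toAdd.injective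
    rw [toAdd_ofAdd, ← cL]
    rcases hall (3 * L) with e | e | e
    · rw [e, map_zero] at c3; rw [h3] at c3; exact absurd c3.symm d10
    · rw [e, map_one]
    · rw [e, map_neg, map_one] at c3; rw [h3] at c3; exact absurd c3 d21
  · right; right
    refine ZHatLevel.ext_of_level fun L => ?_
    have c3 := cast_level_of_dvd (n := 3) (L := 3 * L) (PNat.dvd_iff.1 (dvd_mul_right 3 L)) δ
    have cL := cast_level_of_dvd (n := L) (L := 3 * L) (PNat.dvd_iff.1 (dvd_mul_left L 3)) δ
    rw [ZHatLevel.level_eta, Int.cast_neg, Int.cast_one]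
    apply Multiplicative.toAdd.injective
    rw [toAdd_ofAdd, ← cL]
    rcases hall (3 * L) with e | e | e
    · rw [e, map_zero] at c3; rw [h3] at c3; exact absurd c3.symm d20
    · rw [e, map_one] at c3; rw [h3] at c3; exact absurd c3.symm d21
    · rw [e, map_neg, map_one]

end Wreath

end Literature.AnabelianGeometry.EtaleTheta.SettingModel.Slice2

end
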